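import Literature.Topology.FourManifolds.FramedTubularNbhd
import Literature.Topology.FourManifolds.InverseFunctionTheorem
import Literature.Topology.FourManifolds.SmoothEmbeddingCriteria
import Literature.Topology.FourManifolds.FramedSphereFamilyTransversality
import HarnessLib

/-!
# Straightening a normalised fibre coordinate: the reparametrised tube in which it is the
# fibre projection

Topic `Literature/Topology/FourManifolds` (fact seat
`provefact-Literature.Topology.FourManifolds.Matvey-69322e0896`, rung (H4)
`Literature.Topology.FourManifolds.Matveyev1996_partOne_and_fact_of_dualSpheres` of
`CorkDecompositionMiddleLevel.lean`).  A step towards the topology of the regular neighbourhood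
`V₀ = Nd_N(S_* ∪ P_*)` of the middle-level configuration of the cork decomposition theorem
(Matveyev 1996, arXiv:dg-ga/9505001, p. 1: *"Manifold `V₀` has a free fundamental group and
its second homology are generated by classes of spheres `Sᵢ` and `Pᵢ`"*; Kirby 1996,
arXiv:math/9712231, §3), which the tree presents as a regular sublevel set built from the
**modified fibre coordinates** of the tubes (`ModifiedFibreCoordinate.lean`: a smooth
`F : N → ℝᵇ` on the tube `φᵢ(Sᵃ × ℝᵇ)` vanishing exactly to first order along the core,
`F(φᵢ(x, 0)) = 0`, `d(w ↦ F(φᵢ(x, w)))_0 = id`).  To read off the homotopy type of the thin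
tubes `{‖F‖² < t}` one reparametrises the tube so that `F` *becomes* the fibre coordinate —
the parametric inverse function theorem along the compact zero section (Hirsch, *Differential
Topology* (1976), Ch. 4 §5, proof of Thm. 5.1: an immersion injective on the zero section
embeds a uniform tube; Lang, *Fundamentals of Differential Geometry* (1999), XIV §3; here with
the tree's `isLocalDiffeomorphAt_of_mfderiv`, `exists_injOn_prod_ball`,
`isSmoothEmbedding_of_isLocalDiffeomorph`).  Everything is proved; no definitions, no named
facts:

* `Literature.Topology.FourManifolds.FramedSphereFamily.exists_straightenedTube` — for a framed
  family `S` of `a`-spheres with `b`-dimensional fibre in an `n`-manifold, `a + b = n`, and such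
  an `F` for the `i`-th tube: there are a smooth open embedding `φ : Sᵃ × ℝᵇ → N`, fibre
  preserving into the `ε`-tube of `φᵢ` (`φ(x, w) = φᵢ(x, v)` with `‖v‖ < ε`), with the same
  zero section, such that **`F ∘ φ = σ_ρ ∘ pr₂`** for Mathlib's radial diffeomorphism
  `σ_ρ = univBall 0 ρ : ℝᵇ ≅ B(0, ρ)`, and every point of the `ε`-tube of `φᵢ` at which
  `‖F‖ < ρ` lies on `φ`.  So in the coordinates `φ` the function `F` is the (squeezed) fibre
  projection, and the thin tubes `{z ∈ φᵢ(Sᵃ × B_ε) | ‖F z‖ < s}`, `s ≤ ρ`, are the round tubes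
  `φ(Sᵃ × σ_ρ⁻¹ B_s)`.

## References

* R. Matveyev, *A decomposition of smooth simply-connected h-cobordant 4-manifolds*,
  J. Differential Geom. 44 (1996) 571–582; arXiv:dg-ga/9505001, Proof of Theorem, p. 1.
  [Matveyev1996]
* R. Kirby, *Akbulut's corks and h-cobordisms of smooth, simply connected 4-manifolds*, Turkish
  J. Math. 20 (1996) 85–93; arXiv:math/9712231, §3. [KirbyCorks1996]
* M. W. Hirsch, *Differential Topology*, GTM 33 (1976), Ch. 4 §5, Thm. 5.1. [HirschDT1976]
* J. M. Lee, *Introduction to Smooth Manifolds*, 2nd ed., GTM 218 (2013), Thm. 4.5.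
  [LeeSmoothManifolds2013]
-/

open scoped Manifold ContDiff Topology
open Set Function Filter Metric

noncomputable section

namespace Literature.Topology.FourManifolds

universe u v

namespace FramedSphereFamily

variable {n a b : ℕ} {N : Type u} [TopologicalSpace N]
  [ChartedSpace (EuclideanSpace ℝ (Fin n)) N] [IsManifold (𝓡 n) ∞ N] {ι : Type v}


omit [IsManifold (𝓡 n) ∞ N] in
/-- **A tube of a framed family is a local diffeomorphism at every point** (it is a globally
defined partial diffeomorphism onto its open range, `exists_tube_openPartialHomeomorph`).
[folklore] -/
theorem isLocalDiffeomorphAt_toFun (S : FramedSphereFamily (𝓡 n) N ι a b) (i : ι)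
    (q : (Metric.sphere (0 : EuclideanSpace ℝ (Fin (a + 1))) 1) × EuclideanSpace ℝ (Fin b)) :
    IsLocalDiffeomorphAt ((𝓡 a).prod 𝓘(ℝ, EuclideanSpace ℝ (Fin b))) (𝓡 n) ∞ (S.toFun i) q := by
  haveI : Nonempty
      ((Metric.sphere (0 : EuclideanSpace ℝ (Fin (a + 1))) 1) × EuclideanSpace ℝ (Fin b)) := ⟨q⟩
  obtain ⟨K, hsrc, -, hKq, hK, hK'⟩ := S.exists_tube_openPartialHomeomorph i
  let Kd : PartialDiffeomorph ((𝓡 a).prod 𝓘(ℝ, EuclideanSpace ℝ (Fin b))) (𝓡 n)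
      ((Metric.sphere (0 : EuclideanSpace ℝ (Fin (a + 1))) 1) × EuclideanSpace ℝ (Fin b)) N ∞ :=
    { toPartialEquiv := K.toPartialEquiv
      open_source := K.open_source
      open_target := K.open_target
      contMDiffOn_toFun := hK
      contMDiffOn_invFun := hK' }
  have hq : q ∈ Kd.source := by
    change q ∈ K.source
    rw [hsrc]
    exact mem_univ q
  exact ⟨Kd, hq, fun y _ => (hKq y).symm⟩

/-- **Straightening a normalised fibre coordinate.**  Let `S` be a framed family of
`a`-spheres with `b`-dimensional fibre in the `n`-manifold `N`, `a + b = n`, with tubes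
`φᵢ : Sᵃ × ℝᵇ ↪ N`, and let `F : N → ℝᵇ` be smooth on the `i`-th tube with `F(φᵢ(x, 0)) = 0`
and `d(w ↦ F(φᵢ(x, w)))_0 = id` for every `x` (a modified fibre coordinate,
`exists_modifiedFibreCoordinate`).  Then there are `ε, ρ₀ > 0` and, for every
`0 < ρ ≤ ρ₀`, a smooth embedding `φ : Sᵃ × ℝᵇ → N` with open range such that: `φ` is fibre
preserving into the `ε`-tube of `φᵢ` — `φ(x, w) = φᵢ(x, v)` for some `v` with `‖v‖ < ε` —,
`φ(x, 0) = φᵢ(x, 0)`,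
**`F(φ(x, w)) = σ_ρ(w)`** for all `x, w`, where `σ_ρ = univBall 0 ρ` is Mathlib's radial
diffeomorphism of `ℝᵇ` onto `B(0, ρ)`, and every point `φᵢ(x, v)` with `‖v‖ < ε` and
`‖F(φᵢ(x, v))‖ < ρ` is of the form `φ(x, w)`.  Proof: `G(x, w) = (x, F(φᵢ(x, w)))` is smooth
on `Sᵃ × ℝᵇ` with differential `(v₁, v₂) ↦ (v₁, A v₁ + v₂)` at `(x, 0)`, an isomorphism, so
`G` is a local diffeomorphism near the zero section (`isLocalDiffeomorphAt_of_mfderiv`); being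
the identity on the compact zero section it is injective on a uniform tube `Sᵃ × B_ε`
(`exists_injOn_prod_ball`), hence `G' = G ∘ (id × σ_ε)` is a diffeomorphism of `Sᵃ × ℝᵇ` onto
an open set containing a uniform tube `Sᵃ × B_ρ` (`isSmoothEmbedding_of_isLocalDiffeomorph`,
`contMDiffOn_symm_of_isSmoothEmbedding`, tube lemma), and
`φ = φᵢ ∘ (id × σ_ε) ∘ G'⁻¹ ∘ (id × σ_ρ)` does it (Hirsch 1976, Ch. 4 §5, proof of
Thm. 5.1; Lee 2013, Thm. 4.5).
[cite: HirschDT1976, Ch. 4 §5 Thm. 5.1] [cite: LeeSmoothManifolds2013, Thm. 4.5] -/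
theorem exists_straightenedTube (hab : a + b = n) (S : FramedSphereFamily (𝓡 n) N ι a b) (i : ι)
    {F : N → EuclideanSpace ℝ (Fin b)}
    (hF : ContMDiffOn (𝓡 n) 𝓘(ℝ, EuclideanSpace ℝ (Fin b)) ∞ F (range (S.toFun i)))
    (hF0 : ∀ x, F (S.sphere i x) = 0)
    (hFd : ∀ x, HasFDerivAt (fun w : EuclideanSpace ℝ (Fin b) => F (S.toFun i (x, w)))
      (ContinuousLinearMap.id ℝ (EuclideanSpace ℝ (Fin b))) 0) :
    ∃ (ε ρ₀ : ℝ), 0 < ε ∧ 0 < ρ₀ ∧ ∀ ρ : ℝ, 0 < ρ → ρ ≤ ρ₀ →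
      ∃ φ : (Metric.sphere (0 : EuclideanSpace ℝ (Fin (a + 1))) 1) × EuclideanSpace ℝ (Fin b) → N,
      Manifold.IsSmoothEmbedding ((𝓡 a).prod 𝓘(ℝ, EuclideanSpace ℝ (Fin b))) (𝓡 n) ∞ φ ∧ IsOpen
      (range φ) ∧
      (∀ x w, ∃ v : EuclideanSpace ℝ (Fin b), ‖v‖ < ε ∧ φ (x, w) = S.toFun i (x, v)) ∧
      (∀ x, φ (x, 0) = S.toFun i (x, 0)) ∧
      (∀ x w, F (φ (x, w)) = OpenPartialHomeomorph.univBall (0 : EuclideanSpace ℝ (Fin b)) ρ w) ∧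
      (∀ x (v : EuclideanSpace ℝ (Fin b)), ‖v‖ < ε → ‖F (S.toFun i (x, v))‖ < ρ →
        ∃ w, φ (x, w) = S.toFun i (x, v)) := by
  classical
  haveI : Nonempty (Metric.sphere (0 : EuclideanSpace ℝ (Fin (a + 1))) 1) :=
    ⟨⟨EuclideanSpace.single 0 1, by simp⟩⟩
  -- ### notation
  set k := S.toFun i with hk_def
  have hks : ContMDiff ((𝓡 a).prod 𝓘(ℝ, EuclideanSpace ℝ (Fin b))) (𝓡 n) ∞ k := S.contMDiff i
  have hkinj : Injective k := S.injective i
  have hFk : ContMDiff ((𝓡 a).prod 𝓘(ℝ, EuclideanSpace ℝ (Fin b))) 𝓘(ℝ, EuclideanSpace ℝ (Fin b))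
      ∞ fun q => F (k q) :=
    hF.comp_contMDiff hks fun q => mem_range_self q
  have hF0' : ∀ x, F (k (x, 0)) = 0 := fun x => hF0 x
  -- ### the map `G (x, w) = (x, F (φᵢ (x, w)))`
  set G : (Metric.sphere (0 : EuclideanSpace ℝ (Fin (a + 1))) 1) × EuclideanSpace ℝ (Fin b) →
      (Metric.sphere (0 : EuclideanSpace ℝ (Fin (a + 1))) 1) × EuclideanSpace ℝ (Fin b) :=
    fun q => (q.1, F (k q)) with hG_def
  have hGs : ContMDiff ((𝓡 a).prod 𝓘(ℝ, EuclideanSpace ℝ (Fin b))) ((𝓡 a).prod 𝓘(ℝ, EuclideanSpace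
      ℝ (Fin b))) ∞ G := contMDiff_fst.prodMk hFk
  have hG0 : ∀ x, G (x, 0) = (x, 0) := fun x => by
    simp only [hG_def, hF0']
  -- ### `G` is a local diffeomorphism at the zero section
  have hGloc0 : ∀ x, IsLocalDiffeomorphAt ((𝓡 a).prod 𝓘(ℝ, EuclideanSpace ℝ (Fin b))) ((𝓡 a).prod
      𝓘(ℝ, EuclideanSpace ℝ (Fin b))) ∞ G (x, 0) := by
    intro x
    have h2 : MDifferentiableAt ((𝓡 a).prod 𝓘(ℝ, EuclideanSpace ℝ (Fin b))) 𝓘(ℝ, EuclideanSpace ℝ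
        (Fin b)) (fun q => F (k q))
        (x, 0) := hFk.mdifferentiableAt (by simp)
    set A : EuclideanSpace ℝ (Fin a) →L[ℝ] EuclideanSpace ℝ (Fin b) :=
      mfderiv (𝓡 a) 𝓘(ℝ, EuclideanSpace ℝ (Fin b))
        (fun y : Metric.sphere (0 : EuclideanSpace ℝ (Fin (a + 1))) 1 => F (k (y, ((x,
          (0 : EuclideanSpace ℝ (Fin b))) :
            (Metric.sphere (0 : EuclideanSpace ℝ (Fin (a + 1))) 1) × EuclideanSpace ℝ (Fin b)).2)))
        x with hA_def
    let L : (EuclideanSpace ℝ (Fin a) × EuclideanSpace ℝ (Fin b)) ≃L[ℝ]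
        (EuclideanSpace ℝ (Fin a) × EuclideanSpace ℝ (Fin b)) :=
      (ContinuousLinearEquiv.refl ℝ (EuclideanSpace ℝ (Fin a))).skewProd
        (ContinuousLinearEquiv.refl ℝ (EuclideanSpace ℝ (Fin b))) A
    refine isLocalDiffeomorphAt_of_mfderiv isOpen_univ (mem_univ _) hGs.contMDiffOn
      (by exact_mod_cast le_top) L ?_
    have hsnd : mfderiv 𝓘(ℝ, EuclideanSpace ℝ (Fin b)) 𝓘(ℝ, EuclideanSpace ℝ (Fin b))
        (fun w : EuclideanSpace ℝ (Fin b) => F (k (((x, (0 : EuclideanSpace ℝ (Fin b))) :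
          (Metric.sphere (0 : EuclideanSpace ℝ (Fin (a + 1))) 1) × EuclideanSpace ℝ (Fin b)).1,
            w))) ((x, (0 : EuclideanSpace ℝ (Fin b))) :
          (Metric.sphere (0 : EuclideanSpace ℝ (Fin (a + 1))) 1) × EuclideanSpace ℝ (Fin b)).2 =
        ContinuousLinearMap.id ℝ (EuclideanSpace ℝ (Fin b)) := by
      rw [mfderiv_eq_fderiv]
      exact (hFd x).fderiv
    rw [hG_def, mfderiv_prodMk mdifferentiableAt_fst h2, mfderiv_fst]
    refine ContinuousLinearMap.ext fun v => Prod.ext rfl ?_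
    simp only [ContinuousLinearMap.prod_apply]
    rw [mfderiv_prod_eq_add_apply h2]
    have h22 := (congrArg (fun T => T v.2) hsnd).trans rfl
    rw [h22]
    exact add_comm _ _
  -- ### a uniform tube on which `G` is a local diffeomorphism
  obtain ⟨ε₁, hε₁, hloc⟩ : ∃ ε₁ > 0, ∀ q : (Metric.sphere (0 : EuclideanSpace ℝ (Fin (a + 1))) 1) ×
      EuclideanSpace ℝ (Fin b), ‖q.2‖ < ε₁ → IsLocalDiffeomorphAt ((𝓡 a).prod 𝓘(ℝ, EuclideanSpace
          ℝ (Fin b))) ((𝓡 a).prod 𝓘(ℝ, EuclideanSpace ℝ (Fin b))) ∞ G q := by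
    have hopen := isOpen_setOf_isLocalDiffeomorphAt (I := ((𝓡 a).prod 𝓘(ℝ, EuclideanSpace ℝ (Fin
        b)))) (J := ((𝓡 a).prod 𝓘(ℝ, EuclideanSpace ℝ (Fin b)))) (n := ∞) G
    have hsub : (univ : Set (Metric.sphere (0 : EuclideanSpace ℝ (Fin (a + 1))) 1)) ×ˢ
        ({0} : Set (EuclideanSpace ℝ (Fin b))) ⊆
        {q | IsLocalDiffeomorphAt ((𝓡 a).prod 𝓘(ℝ, EuclideanSpace ℝ (Fin b))) ((𝓡 a).prod 𝓘(ℝ,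
            EuclideanSpace ℝ (Fin b))) ∞ G q} := by
      rintro ⟨x, u⟩ ⟨-, hu⟩
      rw [mem_singleton_iff] at hu
      subst hu
      exact hGloc0 x
    obtain ⟨U, V, -, hV, hU, h0V, hUV⟩ :=
      generalized_tube_lemma isCompact_univ isCompact_singleton hopen hsub
    obtain ⟨ε₁, hε₁, hball⟩ := Metric.isOpen_iff.1 hV 0 (h0V rfl)
    exact ⟨ε₁, hε₁, fun q hq => hUV ⟨hU (mem_univ _), hball (by simpa using hq)⟩⟩
  -- ### a uniform tube on which `G` is injective
  obtain ⟨ε₂, hε₂, hinjOn⟩ : ∃ ε₂ > 0, InjOn G ((univ : Set (Metric.sphere (0 : EuclideanSpace ℝ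
      (Fin (a + 1))) 1)) ×ˢ ball (0 : EuclideanSpace ℝ (Fin b)) ε₂) := by
    refine exists_injOn_prod_ball hGs.continuous ?_ fun x => ?_
    · intro x y hxy
      have h := congrArg Prod.fst hxy
      simpa [hG0] using h
    · obtain ⟨Φ, hx, heq⟩ := hGloc0 x
      exact ⟨Φ.source, Φ.open_source.mem_nhds hx, fun q hq q' hq' hqq' =>
        Φ.injOn hq hq' (by rwa [← heq hq, ← heq hq'])⟩
  set ε : ℝ := min ε₁ ε₂ with hε_def
  have hε : 0 < ε := lt_min hε₁ hε₂
  -- ### the squeezed map `G' = G ∘ (id × σ_ε)`, a diffeomorphism onto an open set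
  set σ := OpenPartialHomeomorph.univBall (0 : EuclideanSpace ℝ (Fin b)) ε with hσ_def
  have hσb : ∀ w, ‖σ w‖ < ε := fun w => by
    simpa [hσ_def] using univBall_mem_ball (F := EuclideanSpace ℝ (Fin b)) hε w
  set G' : (Metric.sphere (0 : EuclideanSpace ℝ (Fin (a + 1))) 1) × EuclideanSpace ℝ (Fin b) →
      (Metric.sphere (0 : EuclideanSpace ℝ (Fin (a + 1))) 1) × EuclideanSpace ℝ (Fin b) :=
    fun q => G (q.1, σ q.2) with hG'_def
  have hG'apply : ∀ q, G' q = (q.1, F (k (q.1, σ q.2))) := fun q => rfl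
  have hld : IsLocalDiffeomorph ((𝓡 a).prod 𝓘(ℝ, EuclideanSpace ℝ (Fin b))) ((𝓡 a).prod 𝓘(ℝ,
      EuclideanSpace ℝ (Fin b))) ∞ G' := by
    intro q
    have h1 := isLocalDiffeomorphAt_prodUnivBall (I := 𝓡 a)
      (M := Metric.sphere (0 : EuclideanSpace ℝ (Fin (a + 1))) 1) (F := EuclideanSpace ℝ (Fin b))
      hε q
    have h2 := hloc (q.1, σ q.2) ((hσb q.2).trans_le (min_le_left _ _))
    exact h1.comp (K := ((𝓡 a).prod 𝓘(ℝ, EuclideanSpace ℝ (Fin b))))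
      (P := (Metric.sphere (0 : EuclideanSpace ℝ (Fin (a + 1))) 1) × EuclideanSpace ℝ (Fin b)) h2
  have hinj' : Injective G' := by
    rintro ⟨x, u⟩ ⟨y, w⟩ hq
    have h := @hinjOn (x, σ u) ⟨mem_univ _, by simpa using (hσb u).trans_le (min_le_right _ _)⟩
      (y, σ w) ⟨mem_univ _, by simpa using (hσb w).trans_le (min_le_right _ _)⟩ hq
    obtain ⟨hxy, huw⟩ := Prod.mk.inj h
    rw [hxy, univBall_injective _ huw]
  have hemb : Manifold.IsSmoothEmbedding ((𝓡 a).prod 𝓘(ℝ, EuclideanSpace ℝ (Fin b))) ((𝓡 a).prod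
      𝓘(ℝ, EuclideanSpace ℝ (Fin b))) ∞ G' :=
    isSmoothEmbedding_of_isLocalDiffeomorph hld hinj' (ContinuousLinearEquiv.refl ℝ _)
  have ho : Topology.IsOpenEmbedding G' := ⟨hemb.isEmbedding, hld.isOpen_range⟩
  set Φ := ho.toOpenPartialHomeomorph G' with hΦ_def
  have hΦapply : ∀ q, Φ q = G' q := fun q => by
    rw [hΦ_def, Topology.IsOpenEmbedding.toOpenPartialHomeomorph_apply]
  have hΦsrc : Φ.source = univ := by
    rw [hΦ_def, Topology.IsOpenEmbedding.toOpenPartialHomeomorph_source]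
  have hΦtgt : Φ.target = range G' := by
    rw [hΦ_def, Topology.IsOpenEmbedding.toOpenPartialHomeomorph_target]
  have hΦsymm : ContMDiffOn ((𝓡 a).prod 𝓘(ℝ, EuclideanSpace ℝ (Fin b))) ((𝓡 a).prod 𝓘(ℝ,
      EuclideanSpace ℝ (Fin b))) ∞ Φ.symm Φ.target := by
    rw [hΦtgt, hΦ_def]
    exact contMDiffOn_symm_of_isSmoothEmbedding hemb ho
  let Φd : PartialDiffeomorph ((𝓡 a).prod 𝓘(ℝ, EuclideanSpace ℝ (Fin b))) ((𝓡 a).prod 𝓘(ℝ,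
      EuclideanSpace ℝ (Fin b)))
      ((Metric.sphere (0 : EuclideanSpace ℝ (Fin (a + 1))) 1) × EuclideanSpace ℝ (Fin b))
      ((Metric.sphere (0 : EuclideanSpace ℝ (Fin (a + 1))) 1) × EuclideanSpace ℝ (Fin b)) ∞ :=
    { toPartialEquiv := Φ.toPartialEquiv
      open_source := Φ.open_source
      open_target := Φ.open_target
      contMDiffOn_toFun := by
        have h : ContMDiffOn ((𝓡 a).prod 𝓘(ℝ, EuclideanSpace ℝ (Fin b))) ((𝓡 a).prod 𝓘(ℝ,
            EuclideanSpace ℝ (Fin b))) ∞ Φ Φ.source := by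
          have hfun : (Φ : _ → _) = G' := funext hΦapply
          rw [hfun]
          exact hemb.contMDiff.contMDiffOn
        exact h
      contMDiffOn_invFun := hΦsymm }
  have hΦdloc : ∀ p ∈ Φ.target, IsLocalDiffeomorphAt ((𝓡 a).prod 𝓘(ℝ, EuclideanSpace ℝ (Fin b)))
      ((𝓡 a).prod 𝓘(ℝ, EuclideanSpace ℝ (Fin b))) ∞ Φ.symm p :=
    fun p hp => Φd.symm.isLocalDiffeomorphAt ((𝓡 a).prod 𝓘(ℝ, EuclideanSpace ℝ (Fin b))) ((𝓡
        a).prod 𝓘(ℝ, EuclideanSpace ℝ (Fin b))) ∞ hp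
  have hleft : ∀ q, Φ.symm (G' q) = q := fun q => by
    rw [hΦ_def]
    exact ho.toOpenPartialHomeomorph_left_inv
  have hright : ∀ p ∈ range G', G' (Φ.symm p) = p := fun p hp => by
    rw [hΦ_def]
    exact Topology.IsOpenEmbedding.toOpenPartialHomeomorph_right_inv G' ho hp
  -- ### a uniform tube inside the range of `G'`
  obtain ⟨ρ₀, hρ₀, hρsub₀⟩ : ∃ ρ₀ > 0, ∀ (x : Metric.sphere (0 : EuclideanSpace ℝ (Fin (a + 1))) 1)
      (u : EuclideanSpace ℝ (Fin b)), ‖u‖ < ρ₀ → (x, u) ∈ range G' := by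
    have hsub : (univ : Set (Metric.sphere (0 : EuclideanSpace ℝ (Fin (a + 1))) 1)) ×ˢ
        ({0} : Set (EuclideanSpace ℝ (Fin b))) ⊆ range G' := by
      rintro ⟨x, u⟩ ⟨-, hu⟩
      rw [mem_singleton_iff] at hu
      subst hu
      refine ⟨(x, 0), ?_⟩
      rw [hG'apply]
      simp only [hσ_def, OpenPartialHomeomorph.univBall_apply_zero, hF0']
    obtain ⟨U, V, -, hV, hU, h0V, hUV⟩ :=
      generalized_tube_lemma isCompact_univ isCompact_singleton ho.isOpen_range hsub
    obtain ⟨ρ, hρ, hball⟩ := Metric.isOpen_iff.1 hV 0 (h0V rfl)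
    exact ⟨ρ, hρ, fun x u hu => hUV ⟨hU (mem_univ _), hball (by simpa using hu)⟩⟩
  refine ⟨ε, ρ₀, hε, hρ₀, fun ρ hρ hρle => ?_⟩
  have hρsub : ∀ (x : Metric.sphere (0 : EuclideanSpace ℝ (Fin (a + 1))) 1)
      (u : EuclideanSpace ℝ (Fin b)), ‖u‖ < ρ → (x, u) ∈ range G' :=
    fun x u hu => hρsub₀ x u (hu.trans_le hρle)
  -- ### the straightened tube
  set τ := OpenPartialHomeomorph.univBall (0 : EuclideanSpace ℝ (Fin b)) ρ with hτ_def
  have hτb : ∀ w, ‖τ w‖ < ρ := fun w => by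
    simpa [hτ_def] using univBall_mem_ball (F := EuclideanSpace ℝ (Fin b)) hρ w
  set Pρ : (Metric.sphere (0 : EuclideanSpace ℝ (Fin (a + 1))) 1) × EuclideanSpace ℝ (Fin b) →
      (Metric.sphere (0 : EuclideanSpace ℝ (Fin (a + 1))) 1) × EuclideanSpace ℝ (Fin b) :=
    fun q => (q.1, τ q.2) with hPρ_def
  set Pε : (Metric.sphere (0 : EuclideanSpace ℝ (Fin (a + 1))) 1) × EuclideanSpace ℝ (Fin b) →
      (Metric.sphere (0 : EuclideanSpace ℝ (Fin (a + 1))) 1) × EuclideanSpace ℝ (Fin b) :=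
    fun q => (q.1, σ q.2) with hPε_def
  set ψ : (Metric.sphere (0 : EuclideanSpace ℝ (Fin (a + 1))) 1) × EuclideanSpace ℝ (Fin b) →
      (Metric.sphere (0 : EuclideanSpace ℝ (Fin (a + 1))) 1) × EuclideanSpace ℝ (Fin b) :=
    fun q => Φ.symm (Pρ q) with hψ_def
  set φ : (Metric.sphere (0 : EuclideanSpace ℝ (Fin (a + 1))) 1) × EuclideanSpace ℝ (Fin b) → N :=
    fun q => k (Pε (ψ q)) with hφ_def
  have hPρmem : ∀ q, Pρ q ∈ range G' := fun q => hρsub q.1 (τ q.2) (hτb q.2)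
  -- `G' (ψ q) = (q.1, τ q.2)`, whence `(ψ q).1 = q.1` and `F (φ q) = τ q.2`
  have hGψ : ∀ q, G' (ψ q) = (q.1, τ q.2) := fun q => hright _ (hPρmem q)
  have hψ1 : ∀ q, (ψ q).1 = q.1 := fun q => by
    have h := congrArg Prod.fst (hGψ q)
    rwa [hG'apply] at h
  have hFφ : ∀ q, F (φ q) = τ q.2 := fun q => by
    have h := congrArg Prod.snd (hGψ q)
    rw [hG'apply] at h
    simp only at h
    rw [← h, hφ_def, hPε_def]
  -- ### local diffeomorphism, injectivity, embedding
  have hφloc : IsLocalDiffeomorph ((𝓡 a).prod 𝓘(ℝ, EuclideanSpace ℝ (Fin b))) (𝓡 n) ∞ φ := by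
    intro q
    have h1 : IsLocalDiffeomorphAt ((𝓡 a).prod 𝓘(ℝ, EuclideanSpace ℝ (Fin b))) ((𝓡 a).prod 𝓘(ℝ,
        EuclideanSpace ℝ (Fin b))) ∞ Pρ q :=
      isLocalDiffeomorphAt_prodUnivBall (I := 𝓡 a)
        (M := Metric.sphere (0 : EuclideanSpace ℝ (Fin (a + 1))) 1) (F := EuclideanSpace ℝ (Fin b))
        hρ q
    have h2 : IsLocalDiffeomorphAt ((𝓡 a).prod 𝓘(ℝ, EuclideanSpace ℝ (Fin b))) ((𝓡 a).prod 𝓘(ℝ,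
        EuclideanSpace ℝ (Fin b))) ∞ Φ.symm (Pρ q) :=
      hΦdloc _ (by rw [hΦtgt]; exact hPρmem q)
    have h3 : IsLocalDiffeomorphAt ((𝓡 a).prod 𝓘(ℝ, EuclideanSpace ℝ (Fin b))) ((𝓡 a).prod 𝓘(ℝ,
        EuclideanSpace ℝ (Fin b))) ∞ Pε (Φ.symm (Pρ q)) :=
      isLocalDiffeomorphAt_prodUnivBall (I := 𝓡 a)
        (M := Metric.sphere (0 : EuclideanSpace ℝ (Fin (a + 1))) 1) (F := EuclideanSpace ℝ (Fin b))
        hε _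
    have h4 : IsLocalDiffeomorphAt ((𝓡 a).prod 𝓘(ℝ, EuclideanSpace ℝ (Fin b))) (𝓡 n) ∞ k (Pε
        (Φ.symm (Pρ q))) :=
      S.isLocalDiffeomorphAt_toFun i _
    exact h1.comp (K := 𝓡 n) (P := N) (h2.comp (K := 𝓡 n) (P := N) (h3.comp (K := 𝓡 n) (P := N) h4))
  have hφinj : Injective φ := by
    intro q q' hqq'
    have h1 : Pε (ψ q) = Pε (ψ q') := hkinj hqq'
    have h2 : ψ q = ψ q' := by
      obtain ⟨h11, h12⟩ := Prod.mk.inj h1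
      exact Prod.ext h11 (univBall_injective _ h12)
    have h3 : G' (ψ q) = G' (ψ q') := by rw [h2]
    rw [hGψ, hGψ] at h3
    obtain ⟨h31, h32⟩ := Prod.mk.inj h3
    exact Prod.ext h31 (univBall_injective _ h32)
  have hdim : Module.finrank ℝ (EuclideanSpace ℝ (Fin a) × EuclideanSpace ℝ (Fin b)) =
      Module.finrank ℝ (EuclideanSpace ℝ (Fin n)) := by
    rw [Module.finrank_prod, finrank_euclideanSpace_fin, finrank_euclideanSpace_fin,
      finrank_euclideanSpace_fin, hab]
  have hφemb : Manifold.IsSmoothEmbedding ((𝓡 a).prod 𝓘(ℝ, EuclideanSpace ℝ (Fin b))) (𝓡 n) ∞ φ :=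
    isSmoothEmbedding_of_isLocalDiffeomorph hφloc hφinj (ContinuousLinearEquiv.ofFinrankEq hdim)
  -- ### the conclusions
  refine ⟨φ, hφemb, hφloc.isOpen_range, fun x w => ?_, fun x => ?_,
    fun x w => hFφ (x, w), fun x v hv hFv => ?_⟩
  · -- fibre preserving into the `ε`-tube
    refine ⟨σ (ψ (x, w)).2, hσb _, ?_⟩
    rw [hφ_def, hPε_def]
    simp only [hψ1 (x, w)]
  · -- zero section
    have hψ0 : ψ (x, 0) = (x, 0) := by
      have h : Pρ (x, 0) = G' (x, 0) := by
        rw [hG'apply, hPρ_def]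
        simp only [hτ_def, hσ_def, OpenPartialHomeomorph.univBall_apply_zero, hF0']
      rw [hψ_def]
      simp only
      rw [h, hleft]
    rw [hφ_def]
    simp only [hψ0, hPε_def, hσ_def, OpenPartialHomeomorph.univBall_apply_zero]
  · -- every point of the `ε`-tube with `‖F‖ < ρ` lies on `φ`
    set v' := σ.symm v with hv'
    have hvt : v ∈ σ.target := by
      rw [hσ_def, OpenPartialHomeomorph.univBall_target _ hε]
      simpa using hv
    have hσv : σ v' = v := σ.right_inv hvt
    set u := F (k (x, v)) with hu
    have hut : u ∈ τ.target := by
      rw [hτ_def, OpenPartialHomeomorph.univBall_target _ hρ]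
      simpa using hFv
    set w := τ.symm u with hw
    have hτw : τ w = u := τ.right_inv hut
    refine ⟨w, ?_⟩
    have hG'v : G' (x, v') = (x, u) := by
      rw [hG'apply]
      simp only [hσv, hu]
    have hψw : ψ (x, w) = (x, v') := by
      rw [hψ_def]
      simp only [hPρ_def, hτw]
      rw [← hG'v, hleft]
    rw [hφ_def]
    simp only [hψw, hPε_def, hσv]

end FramedSphereFamily

end Literature.Topology.FourManifolds

end
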